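import Literature.NumberTheory.LFunctions.DirichletPolynomialMeanValue
import Literature.NumberTheory.LFunctions.DirichletPolynomialGallagher
import Literature.NumberTheory.LFunctions.DirichletPolynomialDiscreteMeanValue
import Literature.NumberTheory.LFunctions.AFEHarmonicSums
import HarnessLib

/-!
# Mean values of products `(∑ u_k k^{-s})(∑ v_l l^{s-1})` on lines of the critical strip

Topic `Literature/NumberTheory/LFunctions`. For two short Dirichlet polynomials supported on a
dyadic-type range `M < k, l ≤ X`, the "two-sided" product
`G(s) = (∑_{k ∈ A} u_k k^{-s}) (∑_{l ∈ B} v_l l^{s-1})` (`A, B ⊆ (M, X]`) has, on every line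
`Re s = σ` with `0 ≤ σ ≤ 1`, first moment
`∫_{-T}^{T} |G(σ+it)| dt ≤ (5T + 18X) · max|u| · max|v| · (X/M)^{3/2}`
UNIFORMLY in `σ` (Cauchy–Schwarz, the mean value theorem for Dirichlet polynomials
`Literature.NumberTheory.LFunctions.dirichletPolynomial_meanSquare_le`, and the elementary
`(∑_{M<k≤X} k^{-2σ})(∑_{M<l≤X} l^{2σ-2}) ≤ (X/M)³` for `0 ≤ σ ≤ 1`).  The point is the
uniformity in `σ`: the two factors compensate each other across the strip, which is what makes
sums over zeros of `ζ` with unknown real parts tractable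
(`Literature/NumberTheory/LFunctions/ZeroSumSobolev.lean`).

* `Literature.NumberTheory.LFunctions.meanSquare_weighted_cpow_neg_le`,
  `Literature.NumberTheory.LFunctions.meanSquare_weighted_cpow_sub_one_le` — mean squares of
  the two factors on `Re s = σ`;
* `Literature.NumberTheory.LFunctions.sum_rpow_mul_sum_rpow_le` — `(∑ k^{-2σ})(∑ l^{2σ-2}) ≤ (X/M)³`;
* `Literature.NumberTheory.LFunctions.integral_norm_twoSided_le` — the first-moment bound;
* `Literature.NumberTheory.LFunctions.strip_integral_norm_twoSided_le` — integrated over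
  `0 ≤ σ ≤ 1` and restricted to `[T₁, T₂] ⊆ [-T, T]`.

## References

* A. Ivić, *The Riemann Zeta-Function* (1985), Theorem 5.2 (mean value theorem).
* H. L. Montgomery, *Topics in Multiplicative Number Theory*, LNM 227 (1971), Ch. 7.
-/

noncomputable section

open Complex MeasureTheory Set Filter Finset intervalIntegral
open scoped Real Topology

namespace Literature.NumberTheory.LFunctions

/-! ## The two factors as standard Dirichlet polynomials in `t` -/

/-- `∑_{k ∈ A} u_k k^{-(σ+it)} = ∑_{n ≤ X} a_n n^{-it}` with `a_n = u_n n^{-σ} 1_A(n)`. [folklore] -/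
theorem sum_weighted_cpow_neg_eq {A : Finset ℕ} {X : ℕ} (hA : A ⊆ Finset.Icc 1 X)
    (u : ℕ → ℝ) (σ t : ℝ) :
    ∑ k ∈ A, (u k : ℂ) * (k : ℂ) ^ (-((σ : ℂ) + t * I))
      = ∑ n ∈ Finset.Icc 1 X,
          (if n ∈ A then (u n : ℂ) * (n : ℂ) ^ (-(σ : ℂ)) else 0) * (n : ℂ) ^ (-((t : ℂ) * I)) := by
  classical
  have e : ∑ n ∈ Finset.Icc 1 X,
      (if n ∈ A then (u n : ℂ) * (n : ℂ) ^ (-(σ : ℂ)) else 0) * (n : ℂ) ^ (-((t : ℂ) * I))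
      = ∑ n ∈ Finset.Icc 1 X, (if n ∈ A then
          (u n : ℂ) * (n : ℂ) ^ (-(σ : ℂ)) * (n : ℂ) ^ (-((t : ℂ) * I)) else 0) := by
    refine Finset.sum_congr rfl fun n _ ↦ ?_
    split_ifs <;> simp
  rw [e, Finset.sum_ite_mem, Finset.inter_eq_right.2 hA]
  refine Finset.sum_congr rfl fun k hk ↦ ?_
  have hk0 : (k : ℂ) ≠ 0 :=
    Nat.cast_ne_zero.2 (by have := (Finset.mem_Icc.1 (hA hk)).1; omega)
  rw [neg_add, Complex.cpow_add _ _ hk0, mul_assoc]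

/-- `∑_{l ∈ B} v_l l^{(σ+it)-1} = ∑_{n ≤ X} b_n n^{-i(-t)}` with `b_n = v_n n^{σ-1} 1_B(n)`. [folklore] -/
theorem sum_weighted_cpow_sub_one_eq {B : Finset ℕ} {X : ℕ} (hB : B ⊆ Finset.Icc 1 X)
    (v : ℕ → ℝ) (σ t : ℝ) :
    ∑ l ∈ B, (v l : ℂ) * (l : ℂ) ^ (((σ : ℂ) + t * I) - 1)
      = ∑ n ∈ Finset.Icc 1 X,
          (if n ∈ B then (v n : ℂ) * (n : ℂ) ^ (((σ - 1 : ℝ)) : ℂ) else 0)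
            * (n : ℂ) ^ (-((((-t : ℝ)) : ℂ) * I)) := by
  classical
  have e : ∑ n ∈ Finset.Icc 1 X,
      (if n ∈ B then (v n : ℂ) * (n : ℂ) ^ (((σ - 1 : ℝ)) : ℂ) else 0)
        * (n : ℂ) ^ (-((((-t : ℝ)) : ℂ) * I))
      = ∑ n ∈ Finset.Icc 1 X, (if n ∈ B then
          (v n : ℂ) * (n : ℂ) ^ (((σ - 1 : ℝ)) : ℂ) * (n : ℂ) ^ (-((((-t : ℝ)) : ℂ) * I)) else 0) := by
    refine Finset.sum_congr rfl fun n _ ↦ ?_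
    split_ifs <;> simp
  rw [e, Finset.sum_ite_mem, Finset.inter_eq_right.2 hB]
  refine Finset.sum_congr rfl fun l hl ↦ ?_
  have hl0 : (l : ℂ) ≠ 0 :=
    Nat.cast_ne_zero.2 (by have := (Finset.mem_Icc.1 (hB hl)).1; omega)
  have hexp : ((σ : ℂ) + t * I) - 1 = (((σ - 1 : ℝ)) : ℂ) + -((((-t : ℝ)) : ℂ) * I) := by
    push_cast; ring
  rw [hexp, Complex.cpow_add _ _ hl0, mul_assoc]

/-! ## Mean squares of the two factors -/

/-- Mean square of `∑_{k∈A} u_k k^{-s}` on `Re s = σ`: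
`∫_{-T}^{T} |∑ u_k k^{-σ-it}|² dt ≤ (5T + 18X) ∑_{k∈A} u_k² k^{-2σ}` (`A ⊆ [1, X]`).
[cite: Ivic1985, Theorem 5.2 (weak form)] -/
theorem meanSquare_weighted_cpow_neg_le {A : Finset ℕ} {X : ℕ} (hA : A ⊆ Finset.Icc 1 X)
    (u : ℕ → ℝ) (σ : ℝ) {T : ℝ} (hT : 0 < T) :
    ∫ t in -T..T, ‖∑ k ∈ A, (u k : ℂ) * (k : ℂ) ^ (-((σ : ℂ) + t * I))‖ ^ 2
      ≤ (5 * T + 18 * X) * ∑ k ∈ A, u k ^ 2 * (k : ℝ) ^ (-2 * σ) := by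
  classical
  set a : ℕ → ℂ := fun n ↦ if n ∈ A then (u n : ℂ) * (n : ℂ) ^ (-(σ : ℂ)) else 0 with ha
  simp_rw [sum_weighted_cpow_neg_eq hA u σ]
  refine (dirichletPolynomial_meanSquare_le a X hT).trans (le_of_eq ?_)
  congr 1
  have e : ∑ n ∈ Finset.Icc 1 X, ‖a n‖ ^ 2
      = ∑ n ∈ Finset.Icc 1 X, (if n ∈ A then u n ^ 2 * (n : ℝ) ^ (-2 * σ) else 0) := by
    refine Finset.sum_congr rfl fun n hn ↦ ?_
    simp only [ha]
    split_ifs with h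
    · have hn0 : 0 < n := by have := (Finset.mem_Icc.1 hn).1; omega
      rw [norm_mul, Complex.norm_real, Real.norm_eq_abs, Complex.norm_natCast_cpow_of_pos hn0,
        mul_pow, sq_abs]
      congr 1
      simp only [neg_re, ofReal_re]
      rw [← Real.rpow_natCast, ← Real.rpow_mul (Nat.cast_nonneg n)]
      norm_num
      ring_nf
    · simp
  rw [e, Finset.sum_ite_mem, Finset.inter_eq_right.2 hA]

/-- Mean square of `∑_{l∈B} v_l l^{s-1}` on `Re s = σ`:
`∫_{-T}^{T} |∑ v_l l^{σ-1+it}|² dt ≤ (5T + 18X) ∑_{l∈B} v_l² l^{2σ-2}` (`B ⊆ [1, X]`).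
[cite: Ivic1985, Theorem 5.2 (weak form)] -/
theorem meanSquare_weighted_cpow_sub_one_le {B : Finset ℕ} {X : ℕ} (hB : B ⊆ Finset.Icc 1 X)
    (v : ℕ → ℝ) (σ : ℝ) {T : ℝ} (hT : 0 < T) :
    ∫ t in -T..T, ‖∑ l ∈ B, (v l : ℂ) * (l : ℂ) ^ (((σ : ℂ) + t * I) - 1)‖ ^ 2
      ≤ (5 * T + 18 * X) * ∑ l ∈ B, v l ^ 2 * (l : ℝ) ^ (2 * σ - 2) := by
  classical
  set b : ℕ → ℂ := fun n ↦ if n ∈ B then (v n : ℂ) * (n : ℂ) ^ (((σ - 1 : ℝ)) : ℂ) else 0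
    with hb
  simp_rw [sum_weighted_cpow_sub_one_eq hB v σ]
  have hrefl := intervalIntegral.integral_comp_neg (a := -T) (b := T)
    (fun t : ℝ ↦ ‖∑ n ∈ Finset.Icc 1 X, b n * (n : ℂ) ^ (-((t : ℂ) * I))‖ ^ 2)
  simp only [neg_neg] at hrefl
  rw [hrefl]
  refine (dirichletPolynomial_meanSquare_le b X hT).trans (le_of_eq ?_)
  congr 1
  have e : ∑ n ∈ Finset.Icc 1 X, ‖b n‖ ^ 2
      = ∑ n ∈ Finset.Icc 1 X, (if n ∈ B then v n ^ 2 * (n : ℝ) ^ (2 * σ - 2) else 0) := by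
    refine Finset.sum_congr rfl fun n hn ↦ ?_
    simp only [hb]
    split_ifs with h
    · have hn0 : 0 < n := by have := (Finset.mem_Icc.1 hn).1; omega
      rw [norm_mul, Complex.norm_real, Real.norm_eq_abs, Complex.norm_natCast_cpow_of_pos hn0,
        mul_pow, sq_abs]
      congr 1
      simp only [ofReal_re]
      rw [← Real.rpow_natCast, ← Real.rpow_mul (Nat.cast_nonneg n)]
      norm_num
      ring_nf
    · simp
  rw [e, Finset.sum_ite_mem, Finset.inter_eq_right.2 hB]

/-! ## The compensation across the strip -/

/-- For `0 ≤ σ ≤ 1` and `1 ≤ M ≤ X`: `(∑_{M<k≤X} k^{-2σ})(∑_{M<l≤X} l^{2σ-2}) ≤ (X/M)³`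
(each term `k^{-2σ} l^{2σ-2} = (l/k)^{2σ} l^{-2} ≤ (X/M)² l^{-2}`, and `∑_{l>M} l^{-2} ≤ 1/M`).
[folklore] -/
theorem sum_rpow_mul_sum_rpow_le {M X : ℕ} (hM : 1 ≤ M) (hMX : M ≤ X) {σ : ℝ} (h0 : 0 ≤ σ)
    (h1 : σ ≤ 1) :
    (∑ k ∈ Finset.Ioc M X, (k : ℝ) ^ (-2 * σ)) * (∑ l ∈ Finset.Ioc M X, (l : ℝ) ^ (2 * σ - 2))
      ≤ ((X : ℝ) / M) ^ 3 := by
  have hM0 : (0 : ℝ) < M := by exact_mod_cast hM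
  have hX0 : (0 : ℝ) < X := by exact_mod_cast (hM.trans hMX)
  have hXM : (1 : ℝ) ≤ (X : ℝ) / M := by
    rw [le_div_iff₀ hM0, one_mul]; exact_mod_cast hMX
  rw [Finset.sum_mul_sum]
  have hterm : ∀ k ∈ Finset.Ioc M X, ∀ l ∈ Finset.Ioc M X,
      (k : ℝ) ^ (-2 * σ) * (l : ℝ) ^ (2 * σ - 2) ≤ ((X : ℝ) / M) ^ 2 * (1 / (l : ℝ) ^ 2) := by
    intro k hk l hl
    obtain ⟨hk1, hk2⟩ := Finset.mem_Ioc.1 hk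
    obtain ⟨hl1, hl2⟩ := Finset.mem_Ioc.1 hl
    have hkpos : (0 : ℝ) < k := by exact_mod_cast (show 0 < k by omega)
    have hlpos : (0 : ℝ) < l := by exact_mod_cast (show 0 < l by omega)
    have hkM : (M : ℝ) ≤ k := by exact_mod_cast hk1.le
    have hlX : (l : ℝ) ≤ X := by exact_mod_cast hl2
    have e : (k : ℝ) ^ (-2 * σ) * (l : ℝ) ^ (2 * σ - 2)
        = ((l : ℝ) / k) ^ (2 * σ) * (1 / (l : ℝ) ^ 2) := by
      rw [Real.div_rpow hlpos.le hkpos.le, Real.rpow_sub hlpos,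
        show (-2 * σ : ℝ) = -(2 * σ) by ring, Real.rpow_neg hkpos.le, Real.rpow_two]
      field_simp
    rw [e]
    refine mul_le_mul_of_nonneg_right ?_ (by positivity)
    have hq0 : (0 : ℝ) ≤ (l : ℝ) / k := by positivity
    rcases le_or_gt ((l : ℝ) / k) 1 with hq | hq
    · calc ((l : ℝ) / k) ^ (2 * σ) ≤ 1 := Real.rpow_le_one hq0 hq (by linarith)
        _ ≤ ((X : ℝ) / M) ^ 2 := one_le_pow₀ hXM
    · have hqXM : (l : ℝ) / k ≤ (X : ℝ) / M := by
        rw [div_le_div_iff₀ hkpos hM0]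
        nlinarith
      calc ((l : ℝ) / k) ^ (2 * σ) ≤ ((l : ℝ) / k) ^ (2 : ℝ) :=
            Real.rpow_le_rpow_of_exponent_le hq.le (by linarith)
        _ = ((l : ℝ) / k) ^ 2 := Real.rpow_two _
        _ ≤ ((X : ℝ) / M) ^ 2 := pow_le_pow_left₀ hq0 hqXM 2
  have hcard : ((Finset.Ioc M X).card : ℝ) ≤ X := by
    rw [Nat.card_Ioc]; exact_mod_cast Nat.sub_le X M
  have hinv : ∑ l ∈ Finset.Ioc M X, (1 : ℝ) / (l : ℝ) ^ 2 ≤ 1 / M := AFE.sum_Ioc_inv_sq_le hM X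
  calc ∑ k ∈ Finset.Ioc M X, ∑ l ∈ Finset.Ioc M X, (k : ℝ) ^ (-2 * σ) * (l : ℝ) ^ (2 * σ - 2)
      ≤ ∑ k ∈ Finset.Ioc M X, ∑ l ∈ Finset.Ioc M X, ((X : ℝ) / M) ^ 2 * (1 / (l : ℝ) ^ 2) :=
        Finset.sum_le_sum fun k hk ↦ Finset.sum_le_sum fun l hl ↦ hterm k hk l hl
    _ = (Finset.Ioc M X).card * (((X : ℝ) / M) ^ 2 * ∑ l ∈ Finset.Ioc M X, 1 / (l : ℝ) ^ 2) := by
        rw [Finset.sum_const, nsmul_eq_mul, ← Finset.mul_sum]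
    _ ≤ X * (((X : ℝ) / M) ^ 2 * (1 / M)) := by
        apply mul_le_mul hcard (mul_le_mul_of_nonneg_left hinv (by positivity)) (by positivity)
          (by positivity)
    _ = ((X : ℝ) / M) ^ 3 := by field_simp

/-! ## The first moment of the product, uniformly in `0 ≤ σ ≤ 1` -/

/-- **First moment of a two-sided product on `Re s = σ`**: for `A, B ⊆ (M, X]` (`1 ≤ M ≤ X`),
real weights `|u| ≤ U` on `A`, `|v| ≤ V` on `B`, `0 ≤ σ ≤ 1` and `T > 0`,
`∫_{-T}^{T} |∑_{A} u_k k^{-s}| |∑_{B} v_l l^{s-1}| dt ≤ (5T + 18X) U V (X/M)^{3/2}`, `s = σ+it`.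
[cite: Ivic1985, Theorem 5.2 (weak form)] -/
theorem integral_norm_twoSided_le {M X : ℕ} (hM : 1 ≤ M) (hMX : M ≤ X) {A B : Finset ℕ}
    (hA : A ⊆ Finset.Ioc M X) (hB : B ⊆ Finset.Ioc M X) {u v : ℕ → ℝ} {U V : ℝ}
    (hU : 0 ≤ U) (hV : 0 ≤ V) (hu : ∀ k ∈ A, |u k| ≤ U) (hv : ∀ l ∈ B, |v l| ≤ V)
    {σ : ℝ} (h0 : 0 ≤ σ) (h1 : σ ≤ 1) {T : ℝ} (hT : 0 < T) :
    ∫ t in -T..T, ‖∑ k ∈ A, (u k : ℂ) * (k : ℂ) ^ (-((σ : ℂ) + t * I))‖ *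
        ‖∑ l ∈ B, (v l : ℂ) * (l : ℂ) ^ (((σ : ℂ) + t * I) - 1)‖
      ≤ (5 * T + 18 * X) * U * V * ((X : ℝ) / M) ^ (3 / 2 : ℝ) := by
  classical
  have hM0 : (0 : ℝ) < M := by exact_mod_cast hM
  have hIcc : Finset.Ioc M X ⊆ Finset.Icc 1 X := fun n hn ↦ by
    simp only [Finset.mem_Ioc, Finset.mem_Icc] at hn ⊢; omega
  have hA' : A ⊆ Finset.Icc 1 X := hA.trans hIcc
  have hB' : B ⊆ Finset.Icc 1 X := hB.trans hIcc
  -- continuity of the two factors (as standard Dirichlet polynomials in `t`)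
  have hcP : Continuous fun t : ℝ ↦ ‖∑ k ∈ A, (u k : ℂ) * (k : ℂ) ^ (-((σ : ℂ) + t * I))‖ := by
    simp_rw [sum_weighted_cpow_neg_eq hA' u σ]
    exact (DirichletPolynomialDiscreteMeanValue.continuous_dirichletPoly _ X).norm
  have hcQ : Continuous fun t : ℝ ↦ ‖∑ l ∈ B, (v l : ℂ) * (l : ℂ) ^ (((σ : ℂ) + t * I) - 1)‖ := by
    simp_rw [sum_weighted_cpow_sub_one_eq hB' v σ]
    exact ((DirichletPolynomialDiscreteMeanValue.continuous_dirichletPoly _ X).comp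
      continuous_neg).norm
  -- Cauchy–Schwarz
  have hCS := Gallagher.integral_mul_le_sqrt_mul_sqrt (by linarith : -T ≤ T) hcP hcQ
  refine hCS.trans ?_
  -- the two mean squares
  have hP := meanSquare_weighted_cpow_neg_le hA' u σ hT
  have hQ := meanSquare_weighted_cpow_sub_one_le hB' v σ hT
  set S₁ : ℝ := ∑ k ∈ Finset.Ioc M X, (k : ℝ) ^ (-2 * σ) with hS₁
  set S₂ : ℝ := ∑ l ∈ Finset.Ioc M X, (l : ℝ) ^ (2 * σ - 2) with hS₂
  have hS₁0 : 0 ≤ S₁ := Finset.sum_nonneg fun k _ ↦ by positivity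
  have hS₂0 : 0 ≤ S₂ := Finset.sum_nonneg fun l _ ↦ by positivity
  have hsumA : ∑ k ∈ A, u k ^ 2 * (k : ℝ) ^ (-2 * σ) ≤ U ^ 2 * S₁ := by
    calc ∑ k ∈ A, u k ^ 2 * (k : ℝ) ^ (-2 * σ) ≤ ∑ k ∈ A, U ^ 2 * (k : ℝ) ^ (-2 * σ) :=
          Finset.sum_le_sum fun k hk ↦ mul_le_mul_of_nonneg_right
            (by have := hu k hk; rw [← sq_abs]; exact pow_le_pow_left₀ (abs_nonneg _) this 2)
            (by positivity)
      _ = U ^ 2 * ∑ k ∈ A, (k : ℝ) ^ (-2 * σ) := by rw [Finset.mul_sum]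
      _ ≤ U ^ 2 * S₁ := mul_le_mul_of_nonneg_left
          (Finset.sum_le_sum_of_subset_of_nonneg hA fun k _ _ ↦ by positivity) (by positivity)
  have hsumB : ∑ l ∈ B, v l ^ 2 * (l : ℝ) ^ (2 * σ - 2) ≤ V ^ 2 * S₂ := by
    calc ∑ l ∈ B, v l ^ 2 * (l : ℝ) ^ (2 * σ - 2) ≤ ∑ l ∈ B, V ^ 2 * (l : ℝ) ^ (2 * σ - 2) :=
          Finset.sum_le_sum fun l hl ↦ mul_le_mul_of_nonneg_right
            (by have := hv l hl; rw [← sq_abs]; exact pow_le_pow_left₀ (abs_nonneg _) this 2)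
            (by positivity)
      _ = V ^ 2 * ∑ l ∈ B, (l : ℝ) ^ (2 * σ - 2) := by rw [Finset.mul_sum]
      _ ≤ V ^ 2 * S₂ := mul_le_mul_of_nonneg_left
          (Finset.sum_le_sum_of_subset_of_nonneg hB fun l _ _ ↦ by positivity) (by positivity)
  have hC0 : 0 ≤ 5 * T + 18 * (X : ℝ) := by positivity
  have hP' : ∫ t in -T..T, ‖∑ k ∈ A, (u k : ℂ) * (k : ℂ) ^ (-((σ : ℂ) + t * I))‖ ^ 2
      ≤ (5 * T + 18 * X) * (U ^ 2 * S₁) := hP.trans (mul_le_mul_of_nonneg_left hsumA hC0)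
  have hQ' : ∫ t in -T..T, ‖∑ l ∈ B, (v l : ℂ) * (l : ℂ) ^ (((σ : ℂ) + t * I) - 1)‖ ^ 2
      ≤ (5 * T + 18 * X) * (V ^ 2 * S₂) := hQ.trans (mul_le_mul_of_nonneg_left hsumB hC0)
  have hSS : S₁ * S₂ ≤ ((X : ℝ) / M) ^ 3 := sum_rpow_mul_sum_rpow_le hM hMX h0 h1
  calc Real.sqrt (∫ t in -T..T, ‖∑ k ∈ A, (u k : ℂ) * (k : ℂ) ^ (-((σ : ℂ) + t * I))‖ ^ 2)
        * Real.sqrt (∫ t in -T..T, ‖∑ l ∈ B, (v l : ℂ) * (l : ℂ) ^ (((σ : ℂ) + t * I) - 1)‖ ^ 2)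
      ≤ Real.sqrt ((5 * T + 18 * X) * (U ^ 2 * S₁)) * Real.sqrt ((5 * T + 18 * X) * (V ^ 2 * S₂)) :=
        mul_le_mul (Real.sqrt_le_sqrt hP') (Real.sqrt_le_sqrt hQ') (Real.sqrt_nonneg _)
          (Real.sqrt_nonneg _)
    _ = (5 * T + 18 * X) * U * V * Real.sqrt (S₁ * S₂) := by
        rw [← Real.sqrt_mul (by positivity)]
        rw [show (5 * T + 18 * X) * (U ^ 2 * S₁) * ((5 * T + 18 * X) * (V ^ 2 * S₂))
          = ((5 * T + 18 * X) * U * V) ^ 2 * (S₁ * S₂) by ring]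
        rw [Real.sqrt_mul (by positivity), Real.sqrt_sq (by positivity)]
    _ ≤ (5 * T + 18 * X) * U * V * Real.sqrt (((X : ℝ) / M) ^ 3) := by
        gcongr
    _ = (5 * T + 18 * X) * U * V * ((X : ℝ) / M) ^ (3 / 2 : ℝ) := by
        congr 1
        rw [Real.sqrt_eq_rpow, ← Real.rpow_natCast, ← Real.rpow_mul (by positivity)]
        norm_num

/-- **The strip integral of a two-sided product**: under the hypotheses of
`integral_norm_twoSided_le` and `-T ≤ T₁ ≤ T₂ ≤ T`,
`∫_0^1 ∫_{T₁}^{T₂} |∑_A u_k k^{-s}| |∑_B v_l l^{s-1}| dt dσ ≤ (5T + 18X) U V (X/M)^{3/2}`.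
[cite: Ivic1985, Theorem 5.2 (weak form)] -/
theorem strip_integral_norm_twoSided_le {M X : ℕ} (hM : 1 ≤ M) (hMX : M ≤ X) {A B : Finset ℕ}
    (hA : A ⊆ Finset.Ioc M X) (hB : B ⊆ Finset.Ioc M X) {u v : ℕ → ℝ} {U V : ℝ}
    (hU : 0 ≤ U) (hV : 0 ≤ V) (hu : ∀ k ∈ A, |u k| ≤ U) (hv : ∀ l ∈ B, |v l| ≤ V)
    {T T₁ T₂ : ℝ} (hT : 0 < T) (hT₁ : -T ≤ T₁) (h12 : T₁ ≤ T₂) (hT₂ : T₂ ≤ T) :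
    ∫ σ in (0 : ℝ)..1, ∫ t in T₁..T₂,
        ‖(∑ k ∈ A, (u k : ℂ) * (k : ℂ) ^ (-((σ : ℂ) + t * I))) *
          (∑ l ∈ B, (v l : ℂ) * (l : ℂ) ^ (((σ : ℂ) + t * I) - 1))‖
      ≤ (5 * T + 18 * X) * U * V * ((X : ℝ) / M) ^ (3 / 2 : ℝ) := by
  classical
  have hIcc : Finset.Ioc M X ⊆ Finset.Icc 1 X := fun n hn ↦ by
    simp only [Finset.mem_Ioc, Finset.mem_Icc] at hn ⊢; omega
  have hA' : A ⊆ Finset.Icc 1 X := hA.trans hIcc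
  have hB' : B ⊆ Finset.Icc 1 X := hB.trans hIcc
  set G : ℝ → ℝ → ℝ := fun σ t ↦
    ‖(∑ k ∈ A, (u k : ℂ) * (k : ℂ) ^ (-((σ : ℂ) + t * I))) *
      (∑ l ∈ B, (v l : ℂ) * (l : ℂ) ^ (((σ : ℂ) + t * I) - 1))‖ with hG
  -- pointwise bound in `σ ∈ [0, 1]`
  have hpt : ∀ σ ∈ Set.Icc (0 : ℝ) 1, ∫ t in T₁..T₂, G σ t
      ≤ (5 * T + 18 * X) * U * V * ((X : ℝ) / M) ^ (3 / 2 : ℝ) := by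
    intro σ hσ
    have hcP : Continuous fun t : ℝ ↦ ‖∑ k ∈ A, (u k : ℂ) * (k : ℂ) ^ (-((σ : ℂ) + t * I))‖ := by
      simp_rw [sum_weighted_cpow_neg_eq hA' u σ]
      exact (DirichletPolynomialDiscreteMeanValue.continuous_dirichletPoly _ X).norm
    have hcQ : Continuous fun t : ℝ ↦ ‖∑ l ∈ B, (v l : ℂ) * (l : ℂ) ^ (((σ : ℂ) + t * I) - 1)‖ := by
      simp_rw [sum_weighted_cpow_sub_one_eq hB' v σ]
      exact ((DirichletPolynomialDiscreteMeanValue.continuous_dirichletPoly _ X).comp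
        continuous_neg).norm
    have hGc : Continuous (G σ) := by
      simp only [hG]
      simp_rw [norm_mul]
      exact hcP.mul hcQ
    have hG0 : ∀ t, 0 ≤ G σ t := fun t ↦ norm_nonneg _
    calc ∫ t in T₁..T₂, G σ t ≤ ∫ t in -T..T, G σ t :=
          intervalIntegral.integral_mono_interval hT₁ h12 hT₂
            (Filter.Eventually.of_forall hG0) (hGc.intervalIntegrable _ _)
      _ = ∫ t in -T..T, ‖∑ k ∈ A, (u k : ℂ) * (k : ℂ) ^ (-((σ : ℂ) + t * I))‖ *
            ‖∑ l ∈ B, (v l : ℂ) * (l : ℂ) ^ (((σ : ℂ) + t * I) - 1)‖ := by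
          simp only [hG, norm_mul]
      _ ≤ _ := integral_norm_twoSided_le hM hMX hA hB hU hV hu hv hσ.1 hσ.2 hT
  have hnn : ∀ σ, 0 ≤ ∫ t in T₁..T₂, G σ t := fun σ ↦
    intervalIntegral.integral_nonneg h12 fun t _ ↦ norm_nonneg _
  rw [intervalIntegral.integral_of_le zero_le_one]
  calc ∫ σ in Set.Ioc (0 : ℝ) 1, ∫ t in T₁..T₂, G σ t
      ≤ ∫ σ in Set.Ioc (0 : ℝ) 1, (5 * T + 18 * X) * U * V * ((X : ℝ) / M) ^ (3 / 2 : ℝ) :=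
        integral_mono_of_nonneg (Filter.Eventually.of_forall hnn) (integrableOn_const (by simp))
          (ae_restrict_of_forall_mem measurableSet_Ioc fun σ hσ ↦
            hpt σ (Set.Ioc_subset_Icc_self hσ))
    _ = (5 * T + 18 * X) * U * V * ((X : ℝ) / M) ^ (3 / 2 : ℝ) := by
        rw [setIntegral_const]; simp

end Literature.NumberTheory.LFunctions
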